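import Literature.Analysis.FluidPDE.KNSSLineInvariantVorticity
import Literature.Analysis.FluidPDE.MildSolutionIsometryCovariance
import HarnessLib

/-!
# Bounded ancient solutions invariant along one direction, III: the Liouville theorem
# (`2½`-dimensional bounded ancient mild solutions are constant in space)

Analysis/FluidPDE proofs file (theorems only), last of three (after `KNSSLineInvariantPlanar`,
`KNSSLineInvariantVorticity`): the folklore corollary of Koch–Nadirashvili–Seregin–Šverák,
*Liouville theorems for the Navier–Stokes equations and applications*, Acta Math. 203 (2009)
83–105 = arXiv:0709.3599, Theorem 5.1 with §4 and Lemma 2.1 (used in the proof of Theorem 6.2,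
arXiv p. 13, under a Type-I rate; classical for `2½`-dimensional flows, Majda–Bertozzi 2002,
§2.3.1):

* `repr_sub_eq_sub_of_ae` — the §4 representative `U` of `u = U + b(t)` differs from a jointly
  continuous `u` by a spatial constant at **every** time (continuity in `t` of both sides, the
  left by the mean value inequality, removes the null set of exceptional times);
* `apply_eq_apply_zero_of_lineInvariant` — **the Liouville theorem**: a bounded ancient mild
  solution (`ν = 1`, duality form `IsBoundedAncientMildSolution 1 u`) which is jointly continuous
  on `(−∞, 0) × ℝ³` and invariant under the translations `x ↦ x + δe₁` (Lean coordinate `1`,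
  KNSS's `x₂`) satisfies `u(t, x) = u(t, 0)` for all `t < 0` and all `x`: the planar components
  are constant (`planar_apply_eq_of_lineInvariant`, Theorem 5.1 through the descent lemma), hence
  so are those of `U` at every time, hence `U(t, ·)` is constant (`repr_const_of_planar_const`,
  Lemma 2.1 and incompressibility), hence `u(t, x) − u(t, 0) = U(t, x) − U(t, 0) = 0`;
* `ae_eq_const_of_lineInvariant` — the same in the shape of the conclusion of the tree's Liouville
  conjectures (`∀ t < 0, ∃ c, u t =ᵐ[volume] fun _ => c`), and the contrapositive
  `not_lineInvariant_of_not_const` used for non-trivial blow-up limits;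
* `apply_eq_apply_zero_of_invariant_along` / `ae_eq_const_of_invariant_along` (appended) — the
  same for invariance along an ARBITRARY direction `e ≠ 0`, by conjugating with the reflection
  taking `e/‖e‖` to `e₁` (`IsBoundedAncientMildSolution.conj_linearIsometryEquiv`,
  `Submodule.reflection_sub`).

Everything rests on DISCHARGED tree theorems (`KNSS2009_liouville_planar_holds`,
`KNSS2009_regularity_boundedWeak_ancient_holds`, `KNSS2009_lemma21_halfball_holds`): the result
is unconditional.

## What is NOT here

The statement for general
viscosity `ν > 0` (the KNSS classes of the tree are written at `ν = 1`), and the weak-class form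
without joint continuity (which would need the modification/drift bridge of `KNSSThm52SliceBridge`
and would conclude `u(t, ·) = b(t)` a.e. for a.e. `t` only).

## References

* G. Koch, N. Nadirashvili, G. Seregin, V. Šverák, *Liouville theorems for the Navier–Stokes
  equations and applications*, Acta Math. 203 (2009) 83–105 = arXiv:0709.3599: Theorem 5.1 and
  its proof (p. 9), Lemma 2.1 (p. 5), §4 (p. 8), proof of Theorem 6.2 (p. 13).
  [KochNadirashviliSereginSverak2009]
* A. J. Majda, A. L. Bertozzi, *Vorticity and Incompressible Flow*, CUP 2002, §2.3.1
  (`2½`-dimensional flows). [MajdaBertozziCUP2002]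
-/

noncomputable section

open Set Function Filter MeasureTheory Topology InnerProductSpace WithLp intervalIntegral
open scoped RealInnerProductSpace Laplacian ContDiff

namespace Literature.Analysis.FluidPDE

/-! ### The Liouville theorem -/

section Liouville

/-- The time lines of a jointly continuous family are continuous on `(−∞, 0)`. [folklore] -/
private theorem continuousOn_timeLine_of_continuousOn' {X Y : Type*} [TopologicalSpace X]
    [TopologicalSpace Y] {u : ℝ → X → Y} (hcont : ContinuousOn (uncurry u) (Iio 0 ×ˢ univ)) (x : X) :
    ContinuousOn (fun t => u t x) (Iio 0) :=
  hcont.comp (f := fun t : ℝ => (t, x)) (continuous_id.prodMk continuous_const).continuousOn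
    fun _ ht => ⟨ht, mem_univ _⟩

/-- **The §4 representative differs from a continuous velocity by a spatial constant at every
time.** If `u` is jointly continuous on `(−∞, 0) × ℝ³`, `u(t) = U(t) + b(t)` a.e. in `x` for a.e.
`t < 0`, and `U` has `C¹` slices with gradients Lipschitz in `t` uniformly in `x`, then
`U(t, x) − U(t, y) = u(t, x) − u(t, y)` for **every** `t < 0` and all `x, y`: at a.e. `t` the two
continuous slices agree up to `b(t)` everywhere; both sides are continuous in `t` (the left by the
mean value inequality), so the null set of exceptional times is empty (KNSS 2009, Lemma 3.1 and
§4: the decomposition `u = v + w + b(t)` of a bounded weak solution). [cite: KochNadirashviliSereginSverak2009, Lemma 3.1 (arXiv p. 7) and §4 (p. 8)] -/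
theorem repr_sub_eq_sub_of_ae {u U : ℝ → (EuclideanSpace ℝ (Fin 3)) → (EuclideanSpace ℝ (Fin 3))} {b : ℝ → (EuclideanSpace ℝ (Fin 3))}
    (hcont : ContinuousOn (uncurry u) (Iio 0 ×ˢ univ))
    (hae : ∀ᵐ t ∂((volume : Measure ℝ).restrict (Iio 0)), u t =ᵐ[volume] fun x => U t x + b t)
    (hsmooth : ∀ t < 0, ContDiff ℝ ∞ (U t))
    (hlip : ∀ k : ℕ, 1 ≤ k → ∃ L : ℝ, ∀ s < 0, ∀ t < 0, ∀ x,
      ‖iteratedFDeriv ℝ k (U t) x - iteratedFDeriv ℝ k (U s) x‖ ≤ L * |t - s|) :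
    ∀ t < 0, ∀ x y : (EuclideanSpace ℝ (Fin 3)), U t x - U t y = u t x - u t y := by
  obtain ⟨L, hL⟩ := hlip 1 le_rfl
  have hslc : ∀ t < 0, Continuous (u t) := fun t ht => continuous_slice_of_continuousOn_Iio hcont ht
  -- at a.e. `t`, everywhere in `x`
  have hgood : ∀ᵐ t ∂((volume : Measure ℝ).restrict (Iio 0)), ∀ x y : (EuclideanSpace ℝ (Fin 3)),
      (U t x - U t y) - (u t x - u t y) = 0 := by
    filter_upwards [hae, ae_restrict_mem measurableSet_Iio] with t ht htneg
    have htneg : t < 0 := htneg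
    have hc : Continuous fun x => U t x + b t := (hsmooth t htneg).continuous.add continuous_const
    have e := Measure.eq_of_ae_eq ht (hslc t htneg) hc
    intro x y
    rw [congr_fun e x, congr_fun e y]
    abel
  -- continuity in `t` of both sides
  intro t ht x y
  have hU : ContinuousOn (fun s => U s x - U s y) (Iio 0) := by
    refine continuousOn_of_norm_sub_le_mul (L := L * ‖x - y‖) fun s hs s' hs' => ?_
    have hs : s < 0 := hs
    have hs' : s' < 0 := hs'
    have hd : Differentiable ℝ (U s' - U s) :=
      ((hsmooth s' hs').sub (hsmooth s hs)).differentiable (by simp)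
    have hbound : ∀ z, ‖fderiv ℝ (U s' - U s) z‖ ≤ L * |s' - s| := fun z => by
      rw [norm_fderiv_eq_norm_iteratedFDeriv_one,
        iteratedFDeriv_sub_apply ((hsmooth s' hs').of_le (natCast_le_contDiff_infty 1)).contDiffAt
          ((hsmooth s hs).of_le (natCast_le_contDiff_infty 1)).contDiffAt]
      exact hL s hs s' hs' z
    have hmv := (convex_univ (𝕜 := ℝ) (E := (EuclideanSpace ℝ (Fin 3)))).norm_image_sub_le_of_norm_fderiv_le
      (fun z _ => hd.differentiableAt) (fun z _ => hbound z) (mem_univ y) (mem_univ x)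
    calc ‖(U s' x - U s' y) - (U s x - U s y)‖ = ‖(U s' - U s) x - (U s' - U s) y‖ := by
          congr 1; simp only [Pi.sub_apply]; abel
      _ ≤ L * |s' - s| * ‖x - y‖ := hmv
      _ = L * ‖x - y‖ * |s' - s| := by ring
  have hu : ContinuousOn (fun s => u s x - u s y) (Iio 0) :=
    (continuousOn_timeLine_of_continuousOn' hcont x).sub (continuousOn_timeLine_of_continuousOn' hcont y)
  have h := eq_of_ae_restrict_Iio_of_continuousOn (hU.sub hu) (hgood.mono fun s hs => hs x y) ht
  exact sub_eq_zero.1 h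

/-- **Liouville theorem for bounded ancient solutions invariant along one direction** (folklore;
Koch–Nadirashvili–Seregin–Šverák 2009, Theorem 5.1 with §4 and Lemma 2.1, cf. the proof of
Theorem 6.2, arXiv p. 13; `2½`-dimensional flows, Majda–Bertozzi §2.3.1). Let `u` be a bounded
ancient mild solution of the Navier–Stokes equations (`ν = 1`, duality form
`IsBoundedAncientMildSolution 1 u`) which is jointly continuous on `(−∞, 0) × ℝ³` and invariant
under the translations `x ↦ x + δe₁` along the Lean coordinate `1`. Then `u(t, ·)` is constant in
space for every `t < 0`: `u(t, x) = u(t, 0)`. Proof: the planar components are constant by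
`planar_apply_eq_of_lineInvariant` (Theorem 5.1 through the descent lemma); the §4
representative `U` of `u = U + b(t)` (`KNSS2009_regularity_boundedWeak_ancient_holds`) then has
constant planar components at every time (`repr_sub_eq_sub_of_ae`), so it is constant in space by
`repr_const_of_planar_const` (Lemma 2.1 on `±∂₀U₁`, `±∂₂U₁` and incompressibility), and
`u(t, x) − u(t, 0) = U(t, x) − U(t, 0) = 0`. [cite: KochNadirashviliSereginSverak2009, Thm 5.1 (arXiv p. 9), §4 (p. 8), Lemma 2.1 (p. 5), proof of Thm 6.2 (p. 13)] -/
theorem apply_eq_apply_zero_of_lineInvariant {u : ℝ → (EuclideanSpace ℝ (Fin 3)) → (EuclideanSpace ℝ (Fin 3))}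
    (hu : IsBoundedAncientMildSolution 1 u) (hcont : ContinuousOn (uncurry u) (Iio 0 ×ˢ univ))
    (hinv : ∀ t < 0, ∀ (x : (EuclideanSpace ℝ (Fin 3))) (δ : ℝ), u t (x + EuclideanSpace.single 1 δ) = u t x) :
    ∀ t < 0, ∀ x : (EuclideanSpace ℝ (Fin 3)), u t x = u t 0 := by
  -- the planar components of `u` are constant in space
  have hplu := planar_apply_eq_of_lineInvariant hu hcont hinv
  -- `u` is a bounded weak solution; its §4 representative
  have hmeas : AEStronglyMeasurable (uncurry u)
      ((volume : Measure (ℝ × (EuclideanSpace ℝ (Fin 3)))).restrict (Iio 0 ×ˢ univ)) :=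
    hcont.aestronglyMeasurable (measurableSet_Iio.prod MeasurableSet.univ)
  have hsl : ∀ t < 0, AEStronglyMeasurable (u t) volume := fun t ht =>
    (continuous_slice_of_continuousOn_Iio hcont ht).aestronglyMeasurable
  have hw : IsBoundedWeakNSSolutionOn (Iio 0) isOpen_Iio 1 u :=
    hu.isBoundedWeakNSSolutionOn one_pos hmeas hsl
  obtain ⟨U, b, hbm, hbC, hUm, hae, hsmooth, hdivU, hbd, hlip, hvort⟩ :=
    KNSS2009_regularity_boundedWeak_ancient_holds hw
  -- the planar components of `U` are constant in space at every time
  have hsub := repr_sub_eq_sub_of_ae hcont hae hsmooth hlip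
  have hplU : ∀ t < 0, ∀ x : (EuclideanSpace ℝ (Fin 3)), U t x 0 = U t 0 0 ∧ U t x 2 = U t 0 2 := by
    intro t ht x
    have h := hsub t ht x 0
    have h0 := congr_arg (fun v : (EuclideanSpace ℝ (Fin 3)) => v 0) h
    have h2 := congr_arg (fun v : (EuclideanSpace ℝ (Fin 3)) => v 2) h
    simp only [PiLp.sub_apply] at h0 h2
    refine ⟨?_, ?_⟩
    · linarith [(hplu t ht x).1]
    · linarith [(hplu t ht x).2]
  -- hence `U(t, ·)` is constant, and so is `u(t, ·)`
  have hU := repr_const_of_planar_const hbm hbC hUm hsmooth hdivU hbd hlip hvort hplU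
  intro t ht x
  have h := hsub t ht x 0
  rw [hU t ht x, sub_self] at h
  exact (sub_eq_zero.1 h.symm)

/-- **The same Liouville theorem in the shape of the conclusion of the Liouville conjectures of
the tree** (`u(t, ·)` is a.e. equal to a constant at every `t < 0`, as in
`LiouvilleConjectureNS` / `AxisymmetricLiouvilleBoundedSwirl`): for a jointly continuous bounded
ancient mild solution invariant under `x ↦ x + δe₁` the conclusion holds — no axial symmetry or
swirl hypothesis is needed in this degenerate ("`2½`-dimensional") case. [cite: KochNadirashviliSereginSverak2009, Thm 5.1 (arXiv p. 9) and proof of Thm 6.2 (p. 13)] -/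
theorem ae_eq_const_of_lineInvariant {u : ℝ → (EuclideanSpace ℝ (Fin 3)) → (EuclideanSpace ℝ (Fin 3))}
    (hu : IsBoundedAncientMildSolution 1 u) (hcont : ContinuousOn (uncurry u) (Iio 0 ×ˢ univ))
    (hinv : ∀ t < 0, ∀ (x : (EuclideanSpace ℝ (Fin 3))) (δ : ℝ), u t (x + EuclideanSpace.single 1 δ) = u t x) :
    ∀ t < 0, ∃ c : (EuclideanSpace ℝ (Fin 3)), u t =ᵐ[volume] fun _ => c := fun t ht =>
  ⟨u t 0, Eventually.of_forall fun x => apply_eq_apply_zero_of_lineInvariant hu hcont hinv t ht x⟩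

/-- **Contrapositive (the form used for blow-up limits):** a jointly continuous bounded ancient
mild solution which is **not** constant in space on some slice is not invariant under the
translations along `e₁` — a non-trivial limit of rescalings must keep a finite distance, in
rescaled units, from any such degeneration (KNSS 2009, proof of Theorem 6.2, p. 13, where the
alternative `x₂`-independence is excluded by Theorem 5.1). [cite: KochNadirashviliSereginSverak2009, proof of Thm 6.2 (arXiv p. 13)] -/
theorem not_lineInvariant_of_not_const {u : ℝ → (EuclideanSpace ℝ (Fin 3)) → (EuclideanSpace ℝ (Fin 3))}
    (hu : IsBoundedAncientMildSolution 1 u) (hcont : ContinuousOn (uncurry u) (Iio 0 ×ˢ univ))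
    (hnc : ∃ t < 0, ∃ x : (EuclideanSpace ℝ (Fin 3)), u t x ≠ u t 0) :
    ¬ ∀ t < 0, ∀ (x : (EuclideanSpace ℝ (Fin 3))) (δ : ℝ), u t (x + EuclideanSpace.single 1 δ) = u t x := by
  intro hinv
  obtain ⟨t, ht, x, hx⟩ := hnc
  exact hx (apply_eq_apply_zero_of_lineInvariant hu hcont hinv t ht x)

end Liouville

/-! ### Invariance along an arbitrary direction -/

section AnyDirection

/-- **The Liouville theorem for invariance along an arbitrary direction** (the class of bounded
ancient mild solutions is invariant under the linear isometries of `ℝ³` — KNSS 2009, §1;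
`IsBoundedAncientMildSolution.conj_linearIsometryEquiv` — so the coordinate direction `e₁` of
`apply_eq_apply_zero_of_lineInvariant` may be replaced by any `e ≠ 0`: conjugate by the reflection
taking `e/‖e‖` to `e₁`). Let `u` be a bounded ancient mild solution (`ν = 1`, duality form), jointly
continuous on `(−∞, 0) × ℝ³` and invariant under the translations `x ↦ x + δ e` along a fixed
vector `e ≠ 0`. Then `u(t, x) = u(t, 0)` for all `t < 0` and all `x`. [cite: KochNadirashviliSereginSverak2009, §1 (rotation invariance of the class), Thm 5.1 (arXiv p. 9) and proof of Thm 6.2 (p. 13)] -/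
theorem apply_eq_apply_zero_of_invariant_along
    {u : ℝ → (EuclideanSpace ℝ (Fin 3)) → (EuclideanSpace ℝ (Fin 3))} {e : EuclideanSpace ℝ (Fin 3)}
    (he : e ≠ 0) (hu : IsBoundedAncientMildSolution 1 u)
    (hcont : ContinuousOn (uncurry u) (Iio 0 ×ˢ univ))
    (hinv : ∀ t < 0, ∀ (x : EuclideanSpace ℝ (Fin 3)) (δ : ℝ), u t (x + δ • e) = u t x) :
    ∀ t < 0, ∀ x : EuclideanSpace ℝ (Fin 3), u t x = u t 0 := by
  -- the unit vectors `e' = e/‖e‖` and `e₁`, and the reflection taking `e'` to `e₁`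
  set e₁ : EuclideanSpace ℝ (Fin 3) := EuclideanSpace.single 1 (1 : ℝ) with he₁_def
  set e' : EuclideanSpace ℝ (Fin 3) := ‖e‖⁻¹ • e with he'_def
  have hne : ‖e‖ ≠ 0 := norm_ne_zero_iff.2 he
  have he' : ‖e'‖ = 1 := by
    rw [he'_def, norm_smul, norm_inv, norm_norm, inv_mul_cancel₀ hne]
  have he₁ : ‖e₁‖ = 1 := by simp [he₁_def]
  set L : EuclideanSpace ℝ (Fin 3) ≃ₗᵢ[ℝ] EuclideanSpace ℝ (Fin 3) :=
    Submodule.reflection (ℝ ∙ (e' - e₁))ᗮ with hL_def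
  have hLe : L e' = e₁ := Submodule.reflection_sub (by rw [he', he₁])
  have hLsymm : L.symm e₁ = e' := by rw [← hLe, LinearIsometryEquiv.symm_apply_apply]
  -- the conjugated field is an `e₁`-invariant, jointly continuous bounded ancient mild solution
  set v : ℝ → EuclideanSpace ℝ (Fin 3) → EuclideanSpace ℝ (Fin 3) := fun t x => L (u t (L.symm x))
    with hv_def
  have hv : IsBoundedAncientMildSolution 1 v := hu.conj_linearIsometryEquiv L
  have hvcont : ContinuousOn (uncurry v) (Iio 0 ×ˢ univ) := by
    have h1 : ContinuousOn (fun p : ℝ × EuclideanSpace ℝ (Fin 3) => (p.1, L.symm p.2)) (Iio 0 ×ˢ univ) :=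
      (continuous_fst.prodMk (L.symm.continuous.comp continuous_snd)).continuousOn
    have h2 := hcont.comp h1 fun p hp => ⟨hp.1, mem_univ _⟩
    exact L.continuous.comp_continuousOn h2
  have hsingle : ∀ δ : ℝ, (EuclideanSpace.single 1 δ : EuclideanSpace ℝ (Fin 3)) = δ • e₁ := by
    intro δ; rw [he₁_def]; ext i; fin_cases i <;> simp
  have hvinv : ∀ t < 0, ∀ (x : EuclideanSpace ℝ (Fin 3)) (δ : ℝ),
      v t (x + EuclideanSpace.single 1 δ) = v t x := by
    intro t ht x δ
    have harg : L.symm (x + EuclideanSpace.single 1 δ) = L.symm x + (δ * ‖e‖⁻¹) • e := by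
      rw [map_add, hsingle, map_smul, hLsymm, he'_def, smul_smul]
    show L (u t (L.symm (x + EuclideanSpace.single 1 δ))) = L (u t (L.symm x))
    rw [harg, hinv t ht]
  have key := apply_eq_apply_zero_of_lineInvariant hv hvcont hvinv
  intro t ht x
  have h := key t ht (L x)
  have h' : L (u t x) = L (u t 0) := by
    simpa [hv_def, LinearIsometryEquiv.symm_apply_apply, map_zero] using h
  exact L.injective h'

/-- The same, in the shape of the conclusion of the tree's Liouville conjectures: an
`e`-invariant (`e ≠ 0`) jointly continuous bounded ancient mild solution is a.e. constant on every
slice. [cite: KochNadirashviliSereginSverak2009, §1 and Thm 5.1 (arXiv p. 9)] -/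
theorem ae_eq_const_of_invariant_along
    {u : ℝ → (EuclideanSpace ℝ (Fin 3)) → (EuclideanSpace ℝ (Fin 3))} {e : EuclideanSpace ℝ (Fin 3)}
    (he : e ≠ 0) (hu : IsBoundedAncientMildSolution 1 u)
    (hcont : ContinuousOn (uncurry u) (Iio 0 ×ˢ univ))
    (hinv : ∀ t < 0, ∀ (x : EuclideanSpace ℝ (Fin 3)) (δ : ℝ), u t (x + δ • e) = u t x) :
    ∀ t < 0, ∃ c : EuclideanSpace ℝ (Fin 3), u t =ᵐ[volume] fun _ => c := fun t ht =>
  ⟨u t 0, Eventually.of_forall fun x => apply_eq_apply_zero_of_invariant_along he hu hcont hinv t ht x⟩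

end AnyDirection

end Literature.Analysis.FluidPDE

end
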